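import Literature.MathematicalPhysics.QuantumLattice.SublatticeSelectiveInteractions
import Literature.MathematicalPhysics.QuantumLattice.PeriodicVariationalEquilibria
import Literature.MathematicalPhysics.QuantumLattice.HubbardTTPrimeMeanEnergyMinimisers
import Literature.MathematicalPhysics.QuantumLattice.InfVolFermionStateBounds
import HarnessLib

/-!
# Sublattice decorations and staggered fields are superlattice-periodic interactions: the periodic
# Gibbs variational principle for decorated and staggered-field Hubbard models

The `T > 0` theory of `q`-PERIODIC interactions (`PeriodicInteractionsCellEnergy` … `PeriodicVariationalEquilibria`:
the periodic variational pressure `P_q`, its two-sided certification from ONE aligned box, the limit along aligned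
boxes, existence of periodic equilibrium states, Griffiths windows for cell-averaged conjugate observables) asks of a
model exactly four structural facts: Hermitian, even, finite range, and `FermionInteraction.IsPeriodic q`
(covariance under the superlattice `L_q = ⊕_i (q_i+1)ℤe_i`). This file supplies them for the ATOMS of the
decorated-lattice / multi-band-by-decoration / staggered-field model class and identifies their conjugate cell
observables:

* §1 cosets vs. the superlattice: `inCoset_add_superlatVec_iff` (cosets are `L_q`-invariant), `inCoset_cellPos_iff_eq_cellRes`
  (exactly one point of the cell, `cellRes q c`, lies in the coset of `c`).
* §2 the sublattice-selective hopping `sublatticeVectorHopping q c v t` is `q`-periodic and of range `‖v‖`.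
* §3 the sublattice on-site term `sublatticeOnSite q c ε U` is `q`-periodic, of every range `R ≥ 0`; for interactions
  supported on singletons the site energy is `ε(x) = ω(Φ{x})` (`siteEnergy_eq_expect_singleton`), so the conjugate CELL
  observable of `sublatticeOnSite q c ε U` is `|C|⁻¹ ω(ε n_{c̄} + U n_{c̄↑}n_{c̄↓})` at the representative `c̄ = pos(res c)`
  (`cellMeanEnergy_sublatticeOnSite`), and that of the number interaction is the cell-averaged density.
* §4 the STAGGERED SPIN TERM `staggeredSpinInteraction d`: `Φ{x} = (−1)^{Σ x_i}(n_{x↑} − n_{x↓})` — Hermitian, even, range `0`,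
  periodic under `evenPeriods d` (period `2` in every direction); its conjugate cell observable is the STAGGERED MAGNETISATION
  per site `m_s(ω) = 2^{-d} Σ_{c ∈ {0,1}^d} (−1)^{|c|} Re ω(n_{c↑} − n_{c↓})` (`cellMeanEnergy_staggeredSpinInteraction`).
* §5 linear families of periodic interactions are periodic (`isPeriodic_linearFamily`); two worked model classes as ONE
  interaction each: the Hubbard model in a chemical potential and a STAGGERED FIELD
  `hubbardStaggered d t U θ = Φ^{t,U} + θ₀ n + θ₁ s_stag` (`θ = (−μ, −h_s)`), and the SUBLATTICE-DECORATED Hubbard model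
  `decoratedHubbard q t U c θ = Φ^{t,U} + Σ_a θ_a n|_{coset c_a}` (ionic Hubbard model, site energies of a decorated `CuO₂`
  cell, pinning fields) — structure theorems, hence (by the files above, instantiated here): the two-sided aligned-box window
  on `P_q` for every real `β` (`abs_perVarPressure_hubbardStaggered_sub_le`), and **Griffiths windows for the staggered
  magnetisation** (`IsPerVarEquilibrium.staggeredMagnetisation_mem_Icc`) **and for the sublattice densities**
  (`IsPerVarEquilibrium.sublatticeDensity_mem_Icc`) of every periodic equilibrium state, fed by three periodic pressures —
  i.e. by aligned-box partition functions.

Everything is PROVED; definitions with bodies: `stagSign`, `evenPeriods`, `staggeredSpinInteraction`,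
`InfVolFermionState.staggeredMagnetisation`, `hubbardStaggered`, `decoratedHubbard`. No named fact, no number.
HONEST SCOPE: no claim that a staggered magnetisation is non-zero anywhere (no phase word); the windows are the
thermodynamic identities `m_s = −∂P/∂h_s` in subgradient form.

## Tree / Mathlib search

REUSED: `InCoset`, `sublatticeVectorHopping(_apply_pair/_apply_eq_zero)`, `sublatticeOnSite(_apply_singleton/_apply_eq_zero)`
(`SublatticeSelectiveInteractions`); `superlatVec`, `FermionInteraction.IsPeriodic`, `siteEnergy(_apply)`, `cellMeanEnergy`, `cellRes`
(`PeriodicInteractionsCellEnergy`); `abs_perVarPressure_sub_boxLogPartitionFn_le` (`PeriodicGibbsVariationalPrinciple`);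
`IsPerVarEquilibrium.cellMeanEnergy_mem_Icc`, `exists_isPerVarEquilibrium` (`PeriodicVariationalEquilibria`); `shiftSet_pair_eq`,
`shiftSet_singleton_eq`, `eq_pair_of_shiftSet_eq`, `eq_singleton_of_shiftSet_eq`, `diam_coe_pair_add`, `hubbardFermionInteraction_*`
(`HubbardTTPrimeMeanEnergyMinimisers`, `InfVolFermionState`); `vectorHoppingFermionInteraction_apply_pair`, `fermionEmbed_shiftEmb_cAt`,
`fermionEmbed_numberOp`, `PolySite.shiftEmb_pt`; `numberInteraction_*` (`TIGroundEnergyDensityResponse`); `linearFamily` closure lemmas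
(`TIGroundEnergyDensityCouplingFamilies`). `lean search 'staggered magnetisation|IsPeriodic sublattice|stagSign'` (2026-08-28): no hits.

## References

* H. Araki, H. Moriya, *Equilibrium statistical mechanics of fermion lattice systems*, Rev. Math. Phys. 15 (2003) 93–198, §4.1, §5, §11.
* R. B. Israel, *Convexity in the Theory of Lattice Gases*, Princeton UP (1979), Thm. I.2.4, §II.3.
* R. B. Griffiths, *A proof that the free energy of a spin system is extensive*, J. Math. Phys. 5 (1964) 1215, Eq. (39).
* E. Pavarini et al., Phys. Rev. Lett. 87 (2001) 047003, eq. (1) (one-band models by decoration).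
-/

noncomputable section

open scoped ComplexOrder BigOperators Matrix.Norms.L2Operator
open Finset Filter Topology

namespace Literature.MathematicalPhysics.QuantumLattice

open Matrix HubbardWave0 Literature.Probability.LatticeModels ThermodynamicLimit

variable {d : ℕ}

/-! ### §1. Cosets and the superlattice -/

/-- **Cosets are invariant under the superlattice**: `x + ℓ ∈ coset(c) ↔ x ∈ coset(c)` for `ℓ ∈ L_q`. [cite: ArakiMoriya2003, §4.1] -/
theorem inCoset_add_superlatVec_iff (q : Fin d → ℕ) (c x : Site d) (z : Fin d → ℤ) :
    InCoset q c (x + superlatVec q z) ↔ InCoset q c x := by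
  refine forall_congr' fun i => ?_
  rw [Pi.add_apply, superlatVec_apply,
    show x i + z i * ((q i : ℤ) + 1) - c i = x i - c i + z i * ((q i : ℤ) + 1) by ring, Int.add_mul_emod_self_right]

/-- **Exactly one point of the cell lies in each coset**: `pos(c') ∈ coset(c) ↔ c' = res(c)`. [cite: ArakiMoriya2003, §4.1] -/
theorem inCoset_cellPos_iff_eq_cellRes (q : Fin d → ℕ) (c : Site d) (c' : Cell q) :
    InCoset q c (cellPos c') ↔ c' = InfVolFermionState.cellRes q c := by
  rw [funext_iff]
  refine forall_congr' fun i => ?_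
  have h0 : (0 : ℤ) < (q i : ℤ) + 1 := by positivity
  have hlt : ((c' i : ℕ) : ℤ) < (q i : ℤ) + 1 := by
    have := (c' i).isLt
    omega
  have hr : 0 ≤ c i % ((q i : ℤ) + 1) := Int.emod_nonneg _ h0.ne'
  show (((c' i : ℕ) : ℤ) - c i) % ((q i : ℤ) + 1) = 0 ↔ _
  rw [← Int.emod_eq_emod_iff_emod_sub_eq_zero, Int.emod_eq_of_lt (by positivity) hlt, Fin.ext_iff,
    show ((InfVolFermionState.cellRes q c i : ℕ)) = (c i % ((q i : ℤ) + 1)).toNat from rfl]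
  constructor
  · intro h
    exact_mod_cast h.trans (Int.toNat_of_nonneg hr).symm
  · intro h
    rw [h, Int.toNat_of_nonneg hr]

/-- The representative `pos(res c)` lies in the coset of `c`. [cite: ArakiMoriya2003, §4.1] -/
theorem inCoset_cellPos_cellRes (q : Fin d → ℕ) (c : Site d) :
    InCoset q c (cellPos (InfVolFermionState.cellRes q c)) :=
  (inCoset_cellPos_iff_eq_cellRes q c _).2 rfl

/-! ### §2. The sublattice-selective hopping is periodic -/

section SubHop

variable (q : Fin d → ℕ) (c : Site d) {v : Site d} (hv : v ≠ 0) (t : ℝ)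
include hv

/-- Bond term of `Φ_{c,v}` at a region known to be a bond `S = {y, z}`, `z = y + v`. [cite: PavariniEtAl2001, eq. (1)] -/
theorem sublatticeVectorHopping_apply_of_eq_pair {S : Finset (Site d)} {y z : Site d}
    (hS : S = {y, z}) (hz : z = y + v) (hy : y ∈ S) (hz' : z ∈ S) :
    (sublatticeVectorHopping q c v t).Φ S =
      if InCoset q c y then -(t : ℂ) • ∑ σ : Fin 2, ((cAt y hy σ)ᴴ * cAt z hz' σ + (cAt z hz' σ)ᴴ * cAt y hy σ) else 0 := by
  subst hz; subst hS
  rw [sublatticeVectorHopping_apply_pair q c hv t y]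
  split_ifs with h
  · exact vectorHoppingFermionInteraction_apply_pair hv t y
  · rfl

/-- **The sublattice-selective hopping along `v ≠ 0` is `q`-periodic**: `Φ_{c,v}(X + ℓ) = Γ(τ_ℓ)(Φ_{c,v} X)` for `ℓ ∈ L_q`
(the coset condition is `L_q`-invariant). [cite: ArakiMoriya2003, §1 assumption (IV) and §8] -/
theorem sublatticeVectorHopping_isPeriodic : (sublatticeVectorHopping q c v t).IsPeriodic q := by
  intro z X
  by_cases h2 : ∃ x : Site d, X = {x, x + v}
  · obtain ⟨x, rfl⟩ := h2
    rw [sublatticeVectorHopping_apply_of_eq_pair q c hv t (shiftSet_pair_eq _ x (x + v)) (add_right_comm x v _)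
        (PolySite.add_mem_shiftSet _ (mem_insert_self _ _))
        (PolySite.add_mem_shiftSet _ (mem_insert_of_mem (mem_singleton_self _))),
      sublatticeVectorHopping_apply_of_eq_pair q c hv t rfl rfl (mem_insert_self _ _)
        (mem_insert_of_mem (mem_singleton_self _))]
    by_cases hx : InCoset q c x
    · rw [if_pos ((inCoset_add_superlatVec_iff q c x z).2 hx), if_pos hx, map_smul, map_sum]
      simp only [map_add, map_mul, fermionEmbed_conjTranspose, fermionEmbed_shiftEmb_cAt]
    · rw [if_neg (fun h => hx ((inCoset_add_superlatVec_iff q c x z).1 h)), if_neg hx, map_zero]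
  have hX : (sublatticeVectorHopping q c v t).Φ X = 0 :=
    sublatticeVectorHopping_apply_eq_zero q c v t fun x hx => h2 ⟨x, hx⟩
  have hS : (sublatticeVectorHopping q c v t).Φ (shiftSet (superlatVec q z) X) = 0 := by
    refine sublatticeVectorHopping_apply_eq_zero q c v t fun y hy => h2 ⟨y - superlatVec q z, ?_⟩
    rw [eq_pair_of_shiftSet_eq hy, add_sub_right_comm]
  rw [hX, hS, map_zero]

omit hv in
/-- **The sublattice-selective hopping along `v` has range `‖v‖`.** [cite: ArakiMoriya2003, §5.4 (finite range potentials)] -/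
theorem sublatticeVectorHopping_hasFiniteRange : (sublatticeVectorHopping q c v t).HasFiniteRange ‖v‖ := by
  intro X hX
  refine sublatticeVectorHopping_apply_eq_zero q c v t fun x hx => ?_
  subst hx
  rw [diam_coe_pair_add] at hX
  exact lt_irrefl _ hX

end SubHop

/-! ### §3. On-site terms: periodicity and the conjugate cell observables -/

section OnSite

variable (q : Fin d → ℕ) (c : Site d) (ε U : ℝ)

/-- On-site term at a region known to be a singleton `S = {y}`. [cite: arXiv9311033, §2 (the Hubbard Hamiltonian)] -/
theorem sublatticeOnSite_apply_of_eq_singleton {S : Finset (Site d)} {y : Site d} (hS : S = {y}) (hy : y ∈ S) :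
    (sublatticeOnSite q c ε U).Φ S =
      if InCoset q c y then (ε : ℂ) • (nAt y hy 0 + nAt y hy 1) + (U : ℂ) • (nAt y hy 0 * nAt y hy 1) else 0 := by
  subst hS
  exact sublatticeOnSite_apply_singleton q c ε U y

/-- **The sublattice on-site term is `q`-periodic.** [cite: ArakiMoriya2003, §1 assumption (IV) and §8] -/
theorem sublatticeOnSite_isPeriodic : (sublatticeOnSite q c ε U).IsPeriodic q := by
  intro z X
  by_cases h1 : ∃ x : Site d, X = {x}
  · obtain ⟨x, rfl⟩ := h1
    rw [sublatticeOnSite_apply_of_eq_singleton q c ε U (shiftSet_singleton_eq _ x)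
        (PolySite.add_mem_shiftSet _ (mem_singleton_self x)),
      sublatticeOnSite_apply_singleton]
    by_cases hx : InCoset q c x
    · rw [if_pos ((inCoset_add_superlatVec_iff q c x z).2 hx), if_pos hx]
      simp only [map_add, map_smul, map_mul, nAt, fermionEmbed_numberOp, PolySite.shiftEmb_pt]
    · rw [if_neg (fun h => hx ((inCoset_add_superlatVec_iff q c x z).1 h)), if_neg hx, map_zero]
  have hX : (sublatticeOnSite q c ε U).Φ X = 0 := sublatticeOnSite_apply_eq_zero q c ε U fun x hx => h1 ⟨x, hx⟩
  have hS : (sublatticeOnSite q c ε U).Φ (shiftSet (superlatVec q z) X) = 0 :=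
    sublatticeOnSite_apply_eq_zero q c ε U fun y hy => h1 ⟨y - superlatVec q z, eq_singleton_of_shiftSet_eq hy⟩
  rw [hX, hS, map_zero]

/-- The sublattice on-site term has range `0` (hence every range `R ≥ 0`). [cite: ArakiMoriya2003, §5.4] -/
theorem sublatticeOnSite_hasFiniteRange (R : ℝ) (hR : 0 ≤ R) : (sublatticeOnSite q c ε U).HasFiniteRange R := by
  intro X hX
  refine sublatticeOnSite_apply_eq_zero q c ε U fun x hx => ?_
  rw [hx, coe_singleton, Metric.diam_singleton] at hX
  exact absurd hX (not_lt.2 hR)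

end OnSite

namespace InfVolFermionState

variable {q : Fin d → ℕ}

/-- **Site energy of an interaction supported on singletons**: `ε(x) = ω(Φ{x})` (any range parameter). [cite: BratteliKishimotoRobinson1978, §3 (mean energy functional)] -/
theorem siteEnergy_eq_expect_singleton {Ψ : FermionInteraction d}
    (h1 : ∀ X : Finset (Site d), (∀ x : Site d, X ≠ {x}) → Ψ.Φ X = 0) (ω : InfVolFermionState d) (R : ℝ) (x : Site d) :
    siteEnergy Ψ ω R x = ω.expect {x} (Ψ.Φ {x}) := by
  rw [siteEnergy_apply, Finset.sum_eq_single_of_mem ({x} : Finset (Site d))]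
  · rw [card_singleton, Nat.cast_one, inv_one, one_mul]
  · exact mem_filter.2 ⟨mem_powerset.2 (singleton_subset_iff.2 (subset_thicken _ R (mem_singleton_self x))), mem_singleton_self x⟩
  · intro Y hY hne
    rw [h1 Y fun y hy => ?_, map_zero, mul_zero]
    subst hy
    exact hne (by rw [mem_singleton.1 (mem_filter.1 hY).2])

/-- **Cell energy density of an interaction supported on singletons**: `ē_q = |C|⁻¹ Σ_{c ∈ C} Re ω(Φ{pos c})`.
[cite: BratteliKishimotoRobinson1978, §3 (mean energy functional)] -/
theorem cellMeanEnergy_eq_of_onSite {Ψ : FermionInteraction d}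
    (h1 : ∀ X : Finset (Site d), (∀ x : Site d, X ≠ {x}) → Ψ.Φ X = 0) (q : Fin d → ℕ) (ω : InfVolFermionState d) (R : ℝ) :
    cellMeanEnergy q Ψ ω R = (Fintype.card (Cell q) : ℝ)⁻¹ * ∑ c : Cell q, (ω.expect {cellPos c} (Ψ.Φ {cellPos c})).re := by
  unfold cellMeanEnergy
  simp only [siteEnergy_eq_expect_singleton h1]

/-- **The conjugate cell observable of the number interaction is the cell-averaged density** `|C|⁻¹ Σ_{c∈C} ρ_{pos c}(ω)` (any state, any `R`).
[cite: ArakiMoriya2003, §5.1] -/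
theorem cellMeanEnergy_numberInteraction (q : Fin d → ℕ) (ω : InfVolFermionState d) (R : ℝ) :
    cellMeanEnergy q (numberInteraction d) ω R = (Fintype.card (Cell q) : ℝ)⁻¹ * ∑ c : Cell q, ω.densityAt (cellPos c) := by
  rw [cellMeanEnergy_eq_of_onSite (fun X hX => numberInteraction_apply_eq_zero hX)]
  simp only [numberInteraction_apply_singleton, densityAt]

/-- **The conjugate cell observable of the sublattice on-site term lives on the representative site**:
`ē_q(Φ^{ε,U}_c)(ω) = |C|⁻¹ Re ω(Φ^{ε,U}_c{c̄})`, `c̄ = pos(res c)` (any state). [cite: ArakiMoriya2003, §4.1] -/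
theorem cellMeanEnergy_sublatticeOnSite (q : Fin d → ℕ) (c : Site d) (ε U : ℝ) (ω : InfVolFermionState d) (R : ℝ) :
    cellMeanEnergy q (sublatticeOnSite q c ε U) ω R =
      (Fintype.card (Cell q) : ℝ)⁻¹ *
        (ω.expect {cellPos (cellRes q c)} ((sublatticeOnSite q c ε U).Φ {cellPos (cellRes q c)})).re := by
  rw [cellMeanEnergy_eq_of_onSite (fun X hX => sublatticeOnSite_apply_eq_zero q c ε U hX),
    Finset.sum_eq_single (cellRes q c)]
  · intro c' _ hne
    rw [sublatticeOnSite_apply_singleton, if_neg (fun h => hne ((inCoset_cellPos_iff_eq_cellRes q c c').1 h)), map_zero,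
      Complex.zero_re]
  · intro h
    exact absurd (mem_univ _) h

/-- The term on the representative site is the full on-site term `ε n_{c̄} + U n_{c̄↑}n_{c̄↓}`. [cite: arXiv9311033, §2] -/
theorem sublatticeOnSite_apply_cellRes (q : Fin d → ℕ) (c : Site d) (ε U : ℝ) :
    (sublatticeOnSite q c ε U).Φ {cellPos (cellRes q c)} =
      (ε : ℂ) • (nAt (cellPos (cellRes q c)) (mem_singleton_self _) 0 + nAt (cellPos (cellRes q c)) (mem_singleton_self _) 1) +
        (U : ℂ) • (nAt (cellPos (cellRes q c)) (mem_singleton_self _) 0 * nAt (cellPos (cellRes q c)) (mem_singleton_self _) 1) := by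
  rw [sublatticeOnSite_apply_singleton, if_pos (inCoset_cellPos_cellRes q c)]

/-- **Sublattice density as a conjugate cell observable**: `ē_q(n|_{coset c})(ω) = |C|⁻¹ ρ_{c̄}(ω)`. [cite: ArakiMoriya2003, §4.1] -/
theorem cellMeanEnergy_sublatticeOnSite_one_zero (q : Fin d → ℕ) (c : Site d) (ω : InfVolFermionState d) (R : ℝ) :
    cellMeanEnergy q (sublatticeOnSite q c 1 0) ω R = (Fintype.card (Cell q) : ℝ)⁻¹ * ω.densityAt (cellPos (cellRes q c)) := by
  rw [cellMeanEnergy_sublatticeOnSite, sublatticeOnSite_apply_cellRes, densityAt]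
  simp only [Complex.ofReal_one, one_smul, Complex.ofReal_zero, zero_smul, add_zero]

end InfVolFermionState

/-! ### §4. The staggered spin term and the staggered magnetisation -/

/-- The staggered sign `(−1)^{Σ_i x_i}` of a site. [cite: KomaTasaki1994, §1] -/
def stagSign (x : Site d) : ℝ := if Even (∑ i, x i) then 1 else -1

/-- Period `2` in every direction: the superlattice `(2ℤ)^d`, under which the staggered sign is invariant. [cite: ArakiMoriya2003, §4.1] -/
def evenPeriods (d : ℕ) : Fin d → ℕ := fun _ => 1

/-- `|stagSign x| = 1`, in the form `stagSign x = 1 ∨ stagSign x = −1`. [cite: KomaTasaki1994, §1] -/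
theorem stagSign_eq_one_or (x : Site d) : stagSign x = 1 ∨ stagSign x = -1 := by
  unfold stagSign
  split_ifs
  · exact Or.inl rfl
  · exact Or.inr rfl

/-- **The staggered sign is `(2ℤ)^d`-invariant.** [cite: KomaTasaki1994, §1] -/
theorem stagSign_add_superlatVec_evenPeriods (x : Site d) (z : Fin d → ℤ) :
    stagSign (x + superlatVec (evenPeriods d) z) = stagSign x := by
  have hs : ∑ i, (x + superlatVec (evenPeriods d) z) i = ∑ i, x i + 2 * ∑ i, z i := by
    simp only [Pi.add_apply, superlatVec_apply, evenPeriods, Nat.cast_one, Finset.sum_add_distrib, Finset.mul_sum]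
    exact congrArg _ (Finset.sum_congr rfl fun i _ => by ring)
  have h2 : Even (2 * ∑ i, z i) := even_two_mul _
  have he : Even (∑ i, (x + superlatVec (evenPeriods d) z) i) ↔ Even (∑ i, x i) := by
    rw [hs, Int.even_add]
    exact ⟨fun h => h.2 h2, fun h => ⟨fun _ => h2, fun _ => h⟩⟩
  unfold stagSign
  by_cases hx : Even (∑ i, x i)
  · rw [if_pos hx, if_pos (he.2 hx)]
  · rw [if_neg hx, if_neg (fun h => hx (he.1 h))]

/-- **The staggered spin interaction** `s_stag`: `Φ{x} = (−1)^{Σ x_i}(n_{x↑} − n_{x↓})`, `Φ X = 0` for `|X| ≠ 1` — the direction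
conjugate to the staggered magnetisation (a staggered Zeeman field `h_s` is the coefficient `−h_s`). [cite: KomaTasaki1994, §1] -/
def staggeredSpinInteraction (d : ℕ) : FermionInteraction d where
  Φ X := ∑ x ∈ X.attach, if X = {x.1} then ((stagSign x.1 : ℝ) : ℂ) • (nAt x.1 x.2 0 - nAt x.1 x.2 1) else 0

/-- On-site term: `Φ{x} = (−1)^{Σ x_i}(n_{x↑} − n_{x↓})`. [cite: KomaTasaki1994, §1] -/
theorem staggeredSpinInteraction_apply_singleton (x : Site d) :
    (staggeredSpinInteraction d).Φ {x} =
      ((stagSign x : ℝ) : ℂ) • (nAt x (mem_singleton_self x) 0 - nAt x (mem_singleton_self x) 1) := by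
  simp only [staggeredSpinInteraction]
  rw [Finset.sum_eq_single ⟨x, mem_singleton_self x⟩, if_pos rfl]
  · rintro ⟨b, hb⟩ - hne
    exact absurd (Subtype.ext (mem_singleton.1 hb)) hne
  · intro h
    exact absurd (mem_attach _ _) h

/-- All other terms vanish. [cite: KomaTasaki1994, §1] -/
theorem staggeredSpinInteraction_apply_eq_zero {X : Finset (Site d)} (h1 : ∀ x : Site d, X ≠ {x}) :
    (staggeredSpinInteraction d).Φ X = 0 := by
  simp only [staggeredSpinInteraction, h1, if_false, sum_const_zero]

/-- Term at a region known to be a singleton. [cite: KomaTasaki1994, §1] -/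
theorem staggeredSpinInteraction_apply_of_eq_singleton {S : Finset (Site d)} {y : Site d} (hS : S = {y}) (hy : y ∈ S) :
    (staggeredSpinInteraction d).Φ S = ((stagSign y : ℝ) : ℂ) • (nAt y hy 0 - nAt y hy 1) := by
  subst hS
  exact staggeredSpinInteraction_apply_singleton y

/-- The staggered spin interaction is even. [cite: ArakiMoriya2003, §1 assumption (II)] -/
theorem staggeredSpinInteraction_isEven : (staggeredSpinInteraction d).IsEven := by
  intro X
  have hn : ∀ (x : Site d) (hx : x ∈ X) (σ : Fin 2), parityAut (nAt x hx σ) = nAt x hx σ := by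
    intro x hx σ
    rw [nAt, numberOp, map_mul, parityAut_creation, parityAut_annihilation, neg_mul_neg]
  simp only [staggeredSpinInteraction, map_sum, apply_ite parityAut, map_zero, map_smul, map_sub, hn]

/-- The staggered spin interaction is Hermitian. [cite: ArakiMoriya2003, §1 assumption (II)] -/
theorem staggeredSpinInteraction_isHermitian : (staggeredSpinInteraction d).IsHermitian := by
  intro X
  have hn : ∀ (x : Site d) (hx : x ∈ X) (σ : Fin 2), (nAt x hx σ)ᴴ = nAt x hx σ := by
    intro x hx σ
    rw [nAt, ← numberAt_orb, (numberAt_isHermitian _).eq]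
  unfold Matrix.IsHermitian
  simp only [staggeredSpinInteraction, Matrix.conjTranspose_sum, apply_ite Matrix.conjTranspose, Matrix.conjTranspose_zero,
    Matrix.conjTranspose_smul, Matrix.conjTranspose_sub, hn, Complex.star_def, Complex.conj_ofReal]

/-- The staggered spin interaction has range `0` (hence every range `R ≥ 0`). [cite: ArakiMoriya2003, §5.4] -/
theorem staggeredSpinInteraction_hasFiniteRange (R : ℝ) (hR : 0 ≤ R) : (staggeredSpinInteraction d).HasFiniteRange R := by
  intro X hX
  refine staggeredSpinInteraction_apply_eq_zero fun x hx => ?_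
  rw [hx, coe_singleton, Metric.diam_singleton] at hX
  exact absurd hX (not_lt.2 hR)

/-- **The staggered spin interaction is `(2ℤ)^d`-periodic** (NOT translation covariant). [cite: ArakiMoriya2003, §1 assumption (IV) and §8] -/
theorem staggeredSpinInteraction_isPeriodic : (staggeredSpinInteraction d).IsPeriodic (evenPeriods d) := by
  intro z X
  by_cases h1 : ∃ x : Site d, X = {x}
  · obtain ⟨x, rfl⟩ := h1
    rw [staggeredSpinInteraction_apply_of_eq_singleton (shiftSet_singleton_eq _ x) (PolySite.add_mem_shiftSet _ (mem_singleton_self x)),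
      staggeredSpinInteraction_apply_singleton, stagSign_add_superlatVec_evenPeriods]
    simp only [map_sub, map_smul, nAt, fermionEmbed_numberOp, PolySite.shiftEmb_pt]
  have hX : (staggeredSpinInteraction d).Φ X = 0 := staggeredSpinInteraction_apply_eq_zero fun x hx => h1 ⟨x, hx⟩
  have hS : (staggeredSpinInteraction d).Φ (shiftSet (superlatVec (evenPeriods d) z) X) = 0 :=
    staggeredSpinInteraction_apply_eq_zero fun y hy => h1 ⟨y - superlatVec (evenPeriods d) z, eq_singleton_of_shiftSet_eq hy⟩
  rw [hX, hS, map_zero]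

namespace InfVolFermionState

/-- **The staggered magnetisation per site** of a state, read on the cell `{0,1}^d` of `(2ℤ)^d`:
`m_s(ω) = 2^{-d} Σ_{c ∈ {0,1}^d} (−1)^{|c|} Re ω(n_{c↑} − n_{c↓})` (for a `(2ℤ)^d`-periodic state this is the density of the
staggered moment). [cite: KomaTasaki1994, §1] -/
def staggeredMagnetisation (ω : InfVolFermionState d) : ℝ :=
  (Fintype.card (Cell (evenPeriods d)) : ℝ)⁻¹ *
    ∑ c : Cell (evenPeriods d), stagSign (cellPos c) *
      (ω.expect {cellPos c} (nAt (cellPos c) (mem_singleton_self _) 0 - nAt (cellPos c) (mem_singleton_self _) 1)).re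

/-- **The conjugate cell observable of the staggered spin term is the staggered magnetisation** (any state, any `R`).
[cite: Griffiths1964, Eq. (39) and Fig. 3] -/
theorem cellMeanEnergy_staggeredSpinInteraction (ω : InfVolFermionState d) (R : ℝ) :
    cellMeanEnergy (evenPeriods d) (staggeredSpinInteraction d) ω R = ω.staggeredMagnetisation := by
  rw [cellMeanEnergy_eq_of_onSite (fun X hX => staggeredSpinInteraction_apply_eq_zero hX)]
  unfold staggeredMagnetisation
  refine congrArg _ (Finset.sum_congr rfl fun c _ => ?_)
  rw [staggeredSpinInteraction_apply_singleton, map_smul, smul_eq_mul, Complex.re_ofReal_mul]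

/-- `|m_s(ω)| ≤ 2` (from `|Re ω(n↑ − n↓)| ≤ ‖n↑ − n↓‖ ≤ 2`; the sharp bound is `1`). [cite: KomaTasaki1994, §1] -/
theorem abs_staggeredMagnetisation_le (ω : InfVolFermionState d) : |ω.staggeredMagnetisation| ≤ 2 := by
  unfold staggeredMagnetisation
  have hcard : (0 : ℝ) < (Fintype.card (Cell (evenPeriods d)) : ℝ) := by exact_mod_cast Fintype.card_pos
  have hterm : ∀ c : Cell (evenPeriods d), |stagSign (cellPos c) *
      (ω.expect {cellPos c} (nAt (cellPos c) (mem_singleton_self _) 0 - nAt (cellPos c) (mem_singleton_self _) 1)).re| ≤ 2 := by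
    intro c
    have hs : |stagSign (cellPos c)| = 1 := by
      rcases stagSign_eq_one_or (cellPos c) with h | h <;> simp [h]
    rw [abs_mul, hs, one_mul]
    refine (Complex.abs_re_le_norm _).trans ((ω.norm_expect_le _ _).trans ?_)
    refine (norm_sub_le _ _).trans ?_
    have h0 : ‖(nAt (cellPos c) (mem_singleton_self (cellPos c)) 0 : FermionOp ({cellPos c} : Finset (Site d)))‖ ≤ 1 :=
      norm_numberOp_le_one _ _
    have h1 : ‖(nAt (cellPos c) (mem_singleton_self (cellPos c)) 1 : FermionOp ({cellPos c} : Finset (Site d)))‖ ≤ 1 :=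
      norm_numberOp_le_one _ _
    linarith
  rw [abs_mul, abs_inv, abs_of_pos hcard]
  calc (Fintype.card (Cell (evenPeriods d)) : ℝ)⁻¹ * |∑ c, stagSign (cellPos c) *
        (ω.expect {cellPos c} (nAt (cellPos c) (mem_singleton_self _) 0 - nAt (cellPos c) (mem_singleton_self _) 1)).re|
      ≤ (Fintype.card (Cell (evenPeriods d)) : ℝ)⁻¹ * ∑ _c : Cell (evenPeriods d), (2 : ℝ) := by
        refine mul_le_mul_of_nonneg_left ((Finset.abs_sum_le_sum_abs _ _).trans (Finset.sum_le_sum fun c _ => hterm c)) ?_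
        positivity
    _ = 2 := by
        rw [Finset.sum_const, Finset.card_univ, nsmul_eq_mul, ← mul_assoc, inv_mul_cancel₀ hcard.ne', one_mul]

end InfVolFermionState

/-! ### §5. Periodic linear families; the staggered-field and the decorated Hubbard models -/

namespace FermionInteraction

/-- **A linear family of `q`-periodic interactions is `q`-periodic.** [cite: ArakiMoriya2003, §1 assumption (IV)] -/
theorem isPeriodic_linearFamily {ι : Type*} [Fintype ι] {q : Fin d → ℕ} {Ψ₀ : FermionInteraction d} {Ψ : ι → FermionInteraction d}
    (h₀ : Ψ₀.IsPeriodic q) (h : ∀ a, (Ψ a).IsPeriodic q) (θ : ι → ℝ) : (linearFamily Ψ₀ Ψ θ).IsPeriodic q := fun z X => by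
  rw [linearFamily_apply, linearFamily_apply, h₀ z X, map_add, map_sum]
  exact congrArg _ (Finset.sum_congr rfl fun a _ => by rw [h a z X, map_smul])

end FermionInteraction

/-- **The Hubbard model in a chemical potential and a staggered field** as ONE `(2ℤ)^d`-periodic interaction:
`Ψ(θ) = Φ^{t,U} + θ₀ n + θ₁ s_stag` (`θ = (−μ, −h_s)`: `H = H^{t,U} − μN − h_s M_stag`). [cite: KomaTasaki1994, §1] -/
def hubbardStaggered (d : ℕ) (t U : ℝ) (θ : Fin 2 → ℝ) : FermionInteraction d :=
  FermionInteraction.linearFamily (hubbardFermionInteraction d t U) ![numberInteraction d, staggeredSpinInteraction d] θ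

/-- Structure of the staggered-field Hubbard model: Hermitian, even, `(2ℤ)^d`-periodic, range `1`.
[cite: ArakiMoriya2003, §1 assumptions (II), (IV) and §5.4] -/
theorem hubbardStaggered_structure (t U : ℝ) (θ : Fin 2 → ℝ) :
    (hubbardStaggered d t U θ).IsHermitian ∧ (hubbardStaggered d t U θ).IsEven ∧
      (hubbardStaggered d t U θ).IsPeriodic (evenPeriods d) ∧ (hubbardStaggered d t U θ).HasFiniteRange 1 := by
  refine ⟨FermionInteraction.isHermitian_linearFamily (hubbardFermionInteraction_isHermitian t U)
      (fun a => by fin_cases a <;> [exact numberInteraction_isHermitian; exact staggeredSpinInteraction_isHermitian]) _,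
    FermionInteraction.isEven_linearFamily (hubbardFermionInteraction_isEven t U)
      (fun a => by fin_cases a <;> [exact numberInteraction_isEven; exact staggeredSpinInteraction_isEven]) _,
    FermionInteraction.isPeriodic_linearFamily ((hubbardFermionInteraction_isTranslationInvariant t U).isPeriodic _)
      (fun a => by fin_cases a <;> [exact numberInteraction_isTranslationInvariant.isPeriodic _;
        exact staggeredSpinInteraction_isPeriodic]) _,
    FermionInteraction.hasFiniteRange_linearFamily (hubbardFermionInteraction_hasFiniteRange t U)
      (fun a => by fin_cases a <;> [exact numberInteraction_hasFiniteRange 1 zero_le_one;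
        exact staggeredSpinInteraction_hasFiniteRange 1 zero_le_one]) _⟩

/-- **TWO-SIDED WINDOW ON THE PRESSURE OF THE STAGGERED-FIELD HUBBARD MODEL FROM ONE EVEN BOX**: for `d ≥ 1`, every real `β`, every
`(t, U, μ, h_s)` and every EVEN `N`, `|P(β) − (log Re Z_{[0,N)^d} + β Re Ψ∅)/N^d| ≤ |β| col_1(N) S/N^d` — a certified
`log Tr e^{−βH_N}` pins the thermodynamic-limit pressure. [cite: BratteliRobinsonII1997, Thm. 6.2.40] [cite: Israel1979, Lemma II.3.1] -/
theorem abs_perVarPressure_hubbardStaggered_sub_le (hd : 0 < d) (t U : ℝ) (θ : Fin 2 → ℝ) (β : ℝ) {N : ℕ} (hN : 1 ≤ N)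
    (hN2 : 2 ∣ N) :
    |(hubbardStaggered d t U θ).perVarPressure β (evenPeriods d) 1 -
        (Real.log (Matrix.partitionFn β ((hubbardStaggered d t U θ).localHamiltonian (halfOpenBox d N))).re +
            β * (((hubbardStaggered d t U θ).Φ ∅) ∅ ∅).re) / (N : ℝ) ^ d| ≤
      |β| * ((((thicken (halfOpenBox d N) 1 \ halfOpenBox d N).card : ℝ) *
        (hubbardStaggered d t U θ).cellSiteNorm (evenPeriods d) 1) / (N : ℝ) ^ d) := by
  obtain ⟨hH, hE, hP, hR⟩ := hubbardStaggered_structure (d := d) t U θ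
  exact FermionInteraction.abs_perVarPressure_sub_boxLogPartitionFn_le hd hH hE hP hR β hN fun _ => hN2

/-- **Periodic equilibrium states of the staggered-field Hubbard model exist** (`d ≥ 1`, every real `β`, every coupling).
[cite: Israel1979, Thm. II.3.2] -/
theorem exists_isPerVarEquilibrium_hubbardStaggered (hd : 0 < d) (β t U : ℝ) (θ : Fin 2 → ℝ) (R : ℝ) :
    ∃ ω : InfVolFermionState d, ω.IsPerVarEquilibrium β (evenPeriods d) (hubbardStaggered d t U θ) R :=
  FermionInteraction.exists_isPerVarEquilibrium hd β _ _ R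

/-- **GRIFFITHS WINDOW FOR THE STAGGERED MAGNETISATION**: for every `(2ℤ)^d`-periodic equilibrium state `ω` of the staggered-field
Hubbard model at inverse temperature `β > 0` and couplings `θ = (−μ, −h_s)`, and every `δ > 0`,
`(P(θ) − P(θ + δe₁))/(βδ) ≤ m_s(ω) ≤ (P(θ − δe₁) − P(θ))/(βδ)` — three periodic pressures, each certified by aligned boxes.
[cite: Griffiths1964, Eq. (39) and Fig. 3] [cite: Israel1979, Thm. I.2.4] -/
theorem InfVolFermionState.IsPerVarEquilibrium.staggeredMagnetisation_mem_Icc {β : ℝ} (hβ : 0 < β) {t U : ℝ} {θ : Fin 2 → ℝ} {R : ℝ}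
    {ω : InfVolFermionState d} (h : ω.IsPerVarEquilibrium β (evenPeriods d) (hubbardStaggered d t U θ) R) {δ : ℝ} (hδ : 0 < δ) :
    ω.staggeredMagnetisation ∈ Set.Icc
      (((hubbardStaggered d t U θ).perVarPressure β (evenPeriods d) R -
          (hubbardStaggered d t U (θ + Pi.single 1 δ)).perVarPressure β (evenPeriods d) R) / (β * δ))
      (((hubbardStaggered d t U (θ + Pi.single 1 (-δ))).perVarPressure β (evenPeriods d) R -
          (hubbardStaggered d t U θ).perVarPressure β (evenPeriods d) R) / (β * δ)) := by
  have h' : ω.IsPerVarEquilibrium β (evenPeriods d)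
      (FermionInteraction.linearFamily (hubbardFermionInteraction d t U) ![numberInteraction d, staggeredSpinInteraction d] θ) R := h
  have hw := h'.cellMeanEnergy_mem_Icc hβ 1 hδ
  rwa [show (![numberInteraction d, staggeredSpinInteraction d] : Fin 2 → FermionInteraction d) 1 = staggeredSpinInteraction d from rfl,
    InfVolFermionState.cellMeanEnergy_staggeredSpinInteraction] at hw

/-- **GRIFFITHS WINDOW FOR THE DENSITY** of the same states (direction `θ₀ = −μ`): the cell-averaged density
`2^{-d} Σ_{c∈{0,1}^d} ρ_c(ω)` lies in `[(P(θ) − P(θ + δe₀))/(βδ), (P(θ − δe₀) − P(θ))/(βδ)]`. [cite: Griffiths1964, Eq. (39) and Fig. 3] -/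
theorem InfVolFermionState.IsPerVarEquilibrium.cellDensity_mem_Icc_hubbardStaggered {β : ℝ} (hβ : 0 < β) {t U : ℝ} {θ : Fin 2 → ℝ}
    {R : ℝ} {ω : InfVolFermionState d} (h : ω.IsPerVarEquilibrium β (evenPeriods d) (hubbardStaggered d t U θ) R) {δ : ℝ} (hδ : 0 < δ) :
    (Fintype.card (Cell (evenPeriods d)) : ℝ)⁻¹ * ∑ c : Cell (evenPeriods d), ω.densityAt (cellPos c) ∈ Set.Icc
      (((hubbardStaggered d t U θ).perVarPressure β (evenPeriods d) R -
          (hubbardStaggered d t U (θ + Pi.single 0 δ)).perVarPressure β (evenPeriods d) R) / (β * δ))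
      (((hubbardStaggered d t U (θ + Pi.single 0 (-δ))).perVarPressure β (evenPeriods d) R -
          (hubbardStaggered d t U θ).perVarPressure β (evenPeriods d) R) / (β * δ)) := by
  have h' : ω.IsPerVarEquilibrium β (evenPeriods d)
      (FermionInteraction.linearFamily (hubbardFermionInteraction d t U) ![numberInteraction d, staggeredSpinInteraction d] θ) R := h
  have hw := h'.cellMeanEnergy_mem_Icc hβ 0 hδ
  rwa [show (![numberInteraction d, staggeredSpinInteraction d] : Fin 2 → FermionInteraction d) 0 = numberInteraction d from rfl,
    InfVolFermionState.cellMeanEnergy_numberInteraction] at hw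

/-- **The sublattice-decorated Hubbard model** as ONE `q`-periodic interaction: `Ψ(θ) = Φ^{t,U} + Σ_a θ_a n|_{coset(c_a)}` — the
Hubbard model with site energies `θ_a` on the sublattices `c_a + L_q` (ionic Hubbard model, the site energies of a decorated
`CuO₂` cell, sublattice pinning fields). [cite: PavariniEtAl2001, eq. (1)] [cite: KomaTasaki1994, §1] -/
def decoratedHubbard {ι : Type*} [Fintype ι] (q : Fin d → ℕ) (t U : ℝ) (c : ι → Site d) (θ : ι → ℝ) : FermionInteraction d :=
  FermionInteraction.linearFamily (hubbardFermionInteraction d t U) (fun a => sublatticeOnSite q (c a) 1 0) θ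

/-- Structure of the decorated Hubbard model: Hermitian, even, `q`-periodic, range `1`. [cite: ArakiMoriya2003, §1 assumptions (II), (IV) and §5.4] -/
theorem decoratedHubbard_structure {ι : Type*} [Fintype ι] (q : Fin d → ℕ) (t U : ℝ) (c : ι → Site d) (θ : ι → ℝ) :
    (decoratedHubbard q t U c θ).IsHermitian ∧ (decoratedHubbard q t U c θ).IsEven ∧
      (decoratedHubbard q t U c θ).IsPeriodic q ∧ (decoratedHubbard q t U c θ).HasFiniteRange 1 :=
  ⟨FermionInteraction.isHermitian_linearFamily (hubbardFermionInteraction_isHermitian t U)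
      (fun a => sublatticeOnSite_isHermitian q (c a) 1 0) _,
    FermionInteraction.isEven_linearFamily (hubbardFermionInteraction_isEven t U) (fun a => sublatticeOnSite_isEven q (c a) 1 0) _,
    FermionInteraction.isPeriodic_linearFamily ((hubbardFermionInteraction_isTranslationInvariant t U).isPeriodic _)
      (fun a => sublatticeOnSite_isPeriodic q (c a) 1 0) _,
    FermionInteraction.hasFiniteRange_linearFamily (hubbardFermionInteraction_hasFiniteRange t U)
      (fun a => sublatticeOnSite_hasFiniteRange q (c a) 1 0 1 zero_le_one) _⟩

/-- **TWO-SIDED WINDOW ON THE PRESSURE OF A DECORATED HUBBARD MODEL FROM ONE ALIGNED BOX** (every real `β`, `(q_i+1) ∣ N`).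
[cite: BratteliRobinsonII1997, Thm. 6.2.40] [cite: Israel1979, Lemma II.3.1] -/
theorem abs_perVarPressure_decoratedHubbard_sub_le {ι : Type*} [Fintype ι] (hd : 0 < d) (q : Fin d → ℕ) (t U : ℝ) (c : ι → Site d)
    (θ : ι → ℝ) (β : ℝ) {N : ℕ} (hN : 1 ≤ N) (hNq : ∀ i, (q i + 1) ∣ N) :
    |(decoratedHubbard q t U c θ).perVarPressure β q 1 -
        (Real.log (Matrix.partitionFn β ((decoratedHubbard q t U c θ).localHamiltonian (halfOpenBox d N))).re +
            β * (((decoratedHubbard q t U c θ).Φ ∅) ∅ ∅).re) / (N : ℝ) ^ d| ≤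
      |β| * ((((thicken (halfOpenBox d N) 1 \ halfOpenBox d N).card : ℝ) * (decoratedHubbard q t U c θ).cellSiteNorm q 1) / (N : ℝ) ^ d) := by
  obtain ⟨hH, hE, hP, hR⟩ := decoratedHubbard_structure q t U c θ
  exact FermionInteraction.abs_perVarPressure_sub_boxLogPartitionFn_le hd hH hE hP hR β hN hNq

/-- **GRIFFITHS WINDOWS FOR THE SUBLATTICE DENSITIES OF A DECORATED HUBBARD MODEL**: for every `q`-periodic equilibrium state `ω`
at `β > 0` and every decorated sublattice `a`, `|C|⁻¹ ρ_{c̄_a}(ω)` (`c̄_a = pos(res c_a)`) lies in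
`[(P_q(θ) − P_q(θ + δe_a))/(βδ), (P_q(θ − δe_a) − P_q(θ))/(βδ)]` (`δ > 0`). [cite: Griffiths1964, Eq. (39) and Fig. 3] [cite: Israel1979, Thm. I.2.4] -/
theorem InfVolFermionState.IsPerVarEquilibrium.sublatticeDensity_mem_Icc {ι : Type*} [Fintype ι] [DecidableEq ι] {q : Fin d → ℕ}
    {β : ℝ} (hβ : 0 < β) {t U : ℝ} {c : ι → Site d} {θ : ι → ℝ} {R : ℝ} {ω : InfVolFermionState d}
    (h : ω.IsPerVarEquilibrium β q (decoratedHubbard q t U c θ) R) (a : ι) {δ : ℝ} (hδ : 0 < δ) :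
    (Fintype.card (Cell q) : ℝ)⁻¹ * ω.densityAt (cellPos (InfVolFermionState.cellRes q (c a))) ∈ Set.Icc
      (((decoratedHubbard q t U c θ).perVarPressure β q R - (decoratedHubbard q t U c (θ + Pi.single a δ)).perVarPressure β q R) /
        (β * δ))
      (((decoratedHubbard q t U c (θ + Pi.single a (-δ))).perVarPressure β q R - (decoratedHubbard q t U c θ).perVarPressure β q R) /
        (β * δ)) := by
  have h' : ω.IsPerVarEquilibrium β q
      (FermionInteraction.linearFamily (hubbardFermionInteraction d t U) (fun a => sublatticeOnSite q (c a) 1 0) θ) R := h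
  have hw := h'.cellMeanEnergy_mem_Icc hβ a hδ
  rwa [InfVolFermionState.cellMeanEnergy_sublatticeOnSite_one_zero] at hw

end Literature.MathematicalPhysics.QuantumLattice

end
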